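import Summits.RiemannHypothesis.RiemannHypothesis.Theorems.ThetaTier2RowSound
import HarnessLib

/-!
# THETA tier-2 kernel rows — twin primes `7757 ≤ q ≤ 8861` (module 11 of 13; cc-s2-1, WEIL typing lane; RH-FREE bookkeeping)

Data module of the tier-2 theta certificate (THETA-CERT-cc6 §E; HOME/cc-s2-1/gen22/TIER2-KERNEL-SPEC.md; soundness chain
`ThetaTier2Check … ThetaTier2RowSound`): the rows `(q, q⁺, m, δ·10¹², menu, k)` — `m = 5`, `δ = ⌊0.98·δ_q·10¹²⌋/10¹²` with
`δ_q = ½ log(q⁺/q)`, menu `0` = thin seed `(1/20, 19/20, 1)`, `η′ = 1/100` (menu `1` = `(1/4, 3/5, 1)`, `η′ = 1/20` for `q = 179, 191`),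
`t₀ = 2⁻¹⁵`; `K = 6`, `τ = 1/100`, `D = 3`, `W_l = 4`, `J = 64` — for the twin primes `7757 ≤ q ≤ 8861` in the range of the route item
`stmt-RiemannHypothesis-19172` (`WallsTenKTwin`, `route-RiemannHypothesis-WeilSemilocal`), checked in the kernel by `Row2.check`
(`decide +kernel`, ≈ 14 s per row), and the resulting REAL statements `T2Valid r.inp r.real ∧ r.RowFacts` (`Row2.check_sound`) that the
E-side assembly turns into `UC(q)`.  Nothing here bears on the truth of RH.
-/

set_option linter.dupNamespace false  -- the mandated namespace repeats `RiemannHypothesis`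

namespace Summit.RiemannHypothesis.RiemannHypothesis.Theorems.ThetaTier2

/-- Twin rows `7757 ≤ q ≤ 8291` (8 rows). [this cell, TIER2-KERNEL-SPEC §4] -/
def twinRows11_1 : List Row2 := [
  ⟨7757, 7759, 5, 126321217, 0, 15⟩, ⟨7877, 7879, 5, 124397055, 0, 15⟩, ⟨7949, 7951, 5, 123270440, 0, 15⟩, ⟨8009, 8011, 5, 122347066, 0, 15⟩,
  ⟨8087, 8089, 5, 121167161, 0, 15⟩, ⟨8219, 8221, 5, 119221411, 0, 15⟩, ⟨8231, 8233, 5, 119047619, 0, 15⟩, ⟨8291, 8293, 5, 118186204, 0, 15⟩ ]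

/-- The kernel verdict for `twinRows11_1`. [this cell, THETA-CERT-cc6 §E6] -/
theorem twinRows11_1_check : twinRows11_1.all Row2.check = true := by
  decide +kernel

/-- (K1)–(K7) and the row facts at every row of `twinRows11_1`. [this cell, THETA-CERT-cc6 §E6] -/
theorem twinRows11_1_valid : ∀ r ∈ twinRows11_1, T2Valid r.inp r.real ∧ r.RowFacts :=
  fun r hr => r.check_sound (List.all_eq_true.1 twinRows11_1_check r hr)

/-- Twin rows `8387 ≤ q ≤ 8861` (8 rows). [this cell, TIER2-KERNEL-SPEC §4] -/
def twinRows11_2 : List Row2 := [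
  ⟨8387, 8389, 5, 116833572, 0, 15⟩, ⟨8429, 8431, 5, 116251483, 0, 15⟩, ⟨8537, 8539, 5, 114780979, 0, 15⟩, ⟨8597, 8599, 5, 113979995, 0, 15⟩,
  ⟨8627, 8629, 5, 113583681, 0, 15⟩, ⟨8819, 8821, 5, 111111111, 0, 15⟩, ⟨8837, 8839, 5, 110884816, 0, 15⟩, ⟨8861, 8863, 5, 110584518, 0, 15⟩ ]

/-- The kernel verdict for `twinRows11_2`. [this cell, THETA-CERT-cc6 §E6] -/
theorem twinRows11_2_check : twinRows11_2.all Row2.check = true := by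
  decide +kernel

/-- (K1)–(K7) and the row facts at every row of `twinRows11_2`. [this cell, THETA-CERT-cc6 §E6] -/
theorem twinRows11_2_valid : ∀ r ∈ twinRows11_2, T2Valid r.inp r.real ∧ r.RowFacts :=
  fun r hr => r.check_sound (List.all_eq_true.1 twinRows11_2_check r hr)

end Summit.RiemannHypothesis.RiemannHypothesis.Theorems.ThetaTier2
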